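import Summits.ValiantsHypothesis.ValiantsHypothesis.Theorems.BarrierLeverAnchoredDoorHitsLowerPairsDTPeel
import Summits.ValiantsHypothesis.ValiantsHypothesis.Theorems.BarrierLeverAnchoredDoorHitsLowerPairsStubGenericPoint

/-!
# Support item `AnchoredDoorHitsLowerPairs` (stmt-ValiantsHypothesis-22510), line `anchored-peeling`:
# ROUTINGS — an `x`-side routing certifies the symbolic minor of the anchored door

Helper file (`--supports stmt-ValiantsHypothesis-22510`; cell valiant-natproofs, rung V4, 𝒟-side door (c); registered line
`Cruxes/AnchoredDoorHitsLowerPairs/Lines/anchored_peeling.lean` v5; prover seat val-np-p1 gen 17). Bookkeeping `def`s: `Stage`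
(one peeling stage = vertex, type list, class assignment), `Stage.newU` / `Stage.newE` (the peeled rows), `Stage.Valid`, `runU` / `runE` /
`ValidSched` (a schedule), `killP` (substitution killing a set of variables). Closes NO item.

**THEOREM (`symbolicDet_ne_zero_of_routing`).** Let `u, w : Fin r → Finset (Fin h)` be any layout with `w` injective and `s ≥ 1`. If a
SCHEDULE of DT-peel stages (file `…DTPeel`), valid stage by stage on the generalized rows it produces (distinct anchor columns, tails
avoiding the vertex / anchor, each link row's class is the FIRST type whose `x`-tail set it contains, shifts disjoint), transforms the
rows `(u i | ∅)` into unit rows `(∅ | w (π i))` for a permutation `π`, then `symbolicDet s h r u w ≠ 0` (hence `AnchoredHit`, by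
`stub_genericPoint`). Ingredients: the DT-peel lemma iterated along the schedule (`genDet_ne_zero_of_schedule`), and the terminal
evaluation `genDet s h r (fun _ => ∅) (w ∘ π) w = ±1` (`genDet_unit_ne_zero`: `[x^∅ y^V] 𝔄_s = [V = ∅]`, via the substitution `killP`
that kills every `x`-variable and fixes `𝔄_s ↦ 1`). This is the TRANSFER of the line's conjecture U1 to the purely combinatorial
ROUTING CONJECTURE «every pair of lower families of equal size admits an `x`-side routing» (memo
HOME/val-np-p1/g17/DTPEEL-MEMO-valnp1-g17.md §3–§6: exhaustive search finds one for every pair on ≤ 4×4 vertices and > 30 000 further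
pairs; no counterexample known). A routing is finite checkable data, so every instance found by search is a kernel certificate via
this theorem (`decide` on `ValidSched`).

WHAT THIS IS NOT: the routing conjecture itself is OPEN — no statement about items 22510 / 19717 beyond the transfer; nothing on crux
stmt-ValiantsHypothesis-14610 or on `VP` versus `VNP`.
-/

set_option linter.dupNamespace false

namespace Summit.ValiantsHypothesis.ValiantsHypothesis.Theorems.BarrierLever.AnchoredPeeling

open Finset MvPolynomial
open Summit.ValiantsHypothesis.ValiantsHypothesis.Theorems.BarrierLever.BrickCalculus
  (pexpo pexpo_def pexpo_le_iff pexpo_sub pexpo_apply_castAdd pexpo_apply_natAdd)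

noncomputable section

namespace DTPeel

variable {h : ℕ}

/-! ## 1. Killing a set of variables; the `x`-free entries of the witness -/

section KillP

variable {R : Type*} [CommSemiring R] {σ : Type*} (p : σ → Prop) [DecidablePred p]

/-- The substitution `x_u := 0` for every `u` with `p u` (all other variables kept). -/
def killP : MvPolynomial σ R →ₐ[R] MvPolynomial σ R :=
  aeval fun u => if p u then 0 else X u

/-- `killP` on a variable. -/
theorem killP_X (u : σ) : killP (R := R) p (X u) = if p u then 0 else X u := by
  rw [killP, aeval_X]

/-- `killP` fixes constants. -/
theorem killP_C (c : R) : killP p (C c) = C c := by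
  rw [killP, ← algebraMap_eq, AlgHom.commutes]

/-- On a monomial: kept iff no killed variable occurs. -/
theorem killP_monomial (m : σ →₀ ℕ) (c : R) :
    killP p (monomial m c) = if (∀ u ∈ m.support, ¬ p u) then monomial m c else 0 := by
  classical
  rw [killP, aeval_monomial, algebraMap_eq]
  by_cases hv : ∀ u ∈ m.support, ¬ p u
  · rw [if_pos hv, monomial_eq]
    congr 1
    rw [Finsupp.prod, Finsupp.prod]
    exact Finset.prod_congr rfl (fun u hu => by rw [if_neg (hv u hu)])
  · rw [if_neg hv]
    push Not at hv
    obtain ⟨u, hmem, hpu⟩ := hv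
    rw [Finsupp.prod, ← Finset.mul_prod_erase _ _ hmem, if_pos hpu, zero_pow (Finsupp.mem_support_iff.mp hmem), zero_mul,
      mul_zero]

/-- **Coefficients after `killP`**: unchanged on monomials avoiding the killed variables, zero otherwise. -/
theorem coeff_killP (f : MvPolynomial σ R) (m : σ →₀ ℕ) :
    coeff m (killP p f) = if (∀ u ∈ m.support, ¬ p u) then coeff m f else 0 := by
  classical
  induction f using MvPolynomial.induction_on' with
  | monomial v c =>
    rw [killP_monomial]
    by_cases hu : ∀ u ∈ v.support, ¬ p u
    · rw [if_pos hu, coeff_monomial]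
      by_cases hum : v = m
      · subst hum; rw [if_pos rfl, if_pos hu]
      · rw [if_neg hum]; split_ifs <;> rfl
    · rw [if_neg hu, coeff_zero, coeff_monomial]
      by_cases hum : v = m
      · subst hum; rw [if_neg hu]
      · rw [if_neg hum]; split_ifs <;> rfl
  | add p' q hp hq =>
    rw [map_add, coeff_add, coeff_add, hp, hq]
    split_ifs <;> simp

end KillP

/-- Predicate «is an `x`-variable». -/
def IsXVar (h : ℕ) (v : Fin (h + h)) : Prop := ∃ a : Fin h, v = Fin.castAdd h a

/-- `IsXVar` is decidable (finite existential). -/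
instance instDecidablePredIsXVar (h : ℕ) : DecidablePred (IsXVar h) := fun _ => Fintype.decidableExistsFintype

/-- Killing every `x`-variable turns each anchor factor into `1`. -/
theorem killP_symbFactor (s : ℕ) {α : Finset (Fin h) × Finset (Fin h)} (hα : α ∈ anchors s h) :
    killP (IsXVar h) (symbFactor h α) = 1 := by
  have hne : α.1.Nonempty := by
    simp only [anchors, Finset.mem_filter, Finset.mem_univ, true_and] at hα
    exact Finset.card_pos.mp hα.1
  obtain ⟨a, ha⟩ := hne
  have hzero : killP (R := MvPolynomial (Param h) ℂ) (IsXVar h) (∏ a' ∈ α.1, X (Fin.castAdd h a')) = 0 := by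
    rw [map_prod]
    exact Finset.prod_eq_zero ha (by rw [killP_X, if_pos ⟨a, rfl⟩])
  rw [symbFactor, map_add, map_one, map_mul, map_mul, map_mul, map_mul, hzero, mul_zero, zero_mul, zero_mul, zero_mul,
    add_zero]

/-- Hence it turns the witness into `1`. -/
theorem killP_symbolicWitness (s h : ℕ) : killP (IsXVar h) (symbolicWitness s h) = 1 := by
  rw [symbolicWitness_eq_prod, map_prod]
  exact Finset.prod_eq_one (fun α hα => killP_symbFactor s hα)

/-- **The `x`-free layout entries of the witness**: `[x^∅ y^V] 𝔄_s = [V = ∅]`. -/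
theorem coeff_pexpo_empty (s h : ℕ) (V : Finset (Fin h)) :
    coeff (pexpo (∅ : Finset (Fin h)) V) (symbolicWitness s h) = if V = ∅ then 1 else 0 := by
  classical
  have hfree : ∀ u ∈ (pexpo (∅ : Finset (Fin h)) V).support, ¬ IsXVar h u := by
    intro u hu ⟨a, hua⟩
    subst hua
    rw [Finsupp.mem_support_iff, pexpo_apply_castAdd, if_neg (Finset.notMem_empty a)] at hu
    exact hu rfl
  have key := coeff_killP (IsXVar h) (symbolicWitness s h) (pexpo (∅ : Finset (Fin h)) V)
  rw [if_pos hfree, killP_symbolicWitness, ← C_1, coeff_C] at key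
  rw [← key]
  by_cases hV : V = ∅
  · subst hV
    rw [if_pos rfl, if_pos]
    rw [pexpo_def, Finset.sum_empty, Finset.sum_empty, add_zero]
  · rw [if_neg hV, if_neg]
    intro h0
    obtain ⟨d, hd⟩ := Finset.nonempty_iff_ne_empty.mpr hV
    have h1 := congrArg (fun m => m (Fin.natAdd h d)) h0
    simp only [Finsupp.coe_zero, Pi.zero_apply, pexpo_apply_natAdd, if_pos hd] at h1
    exact zero_ne_one h1

/-- **Terminal evaluation.** Unit rows `(∅ | w (π i))` against the columns `w` (injective): the generalized layout matrix is
the permutation matrix of `π`, so the generalized minor is `± 1 ≠ 0`. -/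
theorem genDet_unit_ne_zero (s h r : ℕ) (w E : Fin r → Finset (Fin h)) (hw : Function.Injective w) (π : Equiv.Perm (Fin r))
    (hE : ∀ i, E i = w (π i)) : genDet s h r (fun _ => ∅) E w ≠ 0 := by
  classical
  have hM : genMatrix s h r (fun _ => ∅) E w = π.permMatrix (MvPolynomial (Param h) ℂ) := by
    refine Matrix.ext (fun i j => ?_)
    rw [genMatrix, Matrix.of_apply, genEntry, Equiv.Perm.permMatrix, PEquiv.toMatrix_apply, Equiv.toPEquiv_apply, hE i]
    simp only [Option.mem_def, Option.some.injEq]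
    by_cases hj : π i = j
    · subst hj
      rw [if_pos subset_rfl, Finset.sdiff_self, coeff_pexpo_empty, if_pos rfl, if_pos rfl]
    · rw [if_neg hj]
      by_cases hsub : w (π i) ⊆ w j
      · rw [if_pos hsub, coeff_pexpo_empty, if_neg]
        intro h0
        exact hj (hw (Finset.Subset.antisymm hsub (Finset.sdiff_eq_empty_iff_subset.mp h0)))
      · rw [if_neg hsub]
  rw [genDet, hM, Matrix.det_permutation]
  rcases Int.units_eq_one_or (Equiv.Perm.sign π) with h1 | h1 <;> simp [h1]

/-! ## 2. Schedules of DT-peel stages -/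

/-- One peeling stage on `r` generalized rows in dimension `h`: the vertex `a`, the type list `(B, c, D)` of length `J`, and the
class assignment `cls` (only its values on link rows matter). -/
structure Stage (h r : ℕ) where
  /-- the peeled `x`-vertex -/
  a : Fin h
  /-- number of types -/
  J : ℕ
  /-- `x`-tail sets -/
  B : Fin J → Finset (Fin h)
  /-- anchor columns -/
  c : Fin J → Fin h
  /-- `y`-tail sets -/
  D : Fin J → Finset (Fin h)
  /-- class of each row -/
  cls : Fin r → Fin J

namespace Stage

variable {r : ℕ} (σ : Stage h r)

/-- The peeled `x`-sets. -/
def newU (U : Fin r → Finset (Fin h)) : Fin r → Finset (Fin h) :=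
  fun i => if σ.a ∈ U i then ((U i).erase σ.a) \ σ.B (σ.cls i) else U i

/-- The peeled `y`-shifts. -/
def newE (U E : Fin r → Finset (Fin h)) : Fin r → Finset (Fin h) :=
  fun i => if σ.a ∈ U i then E i ∪ insert (σ.c (σ.cls i)) (σ.D (σ.cls i)) else E i

/-- Validity of a stage on the rows `(U | E)` (the hypotheses of the DT-peel lemma). -/
def Valid (U E : Fin r → Finset (Fin h)) : Prop :=
  Function.Injective σ.c ∧ (∀ j, σ.a ∉ σ.B j) ∧ (∀ j, σ.c j ∉ σ.D j) ∧
    (∀ i, σ.a ∈ U i → σ.B (σ.cls i) ⊆ (U i).erase σ.a) ∧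
    (∀ i, σ.a ∈ U i → ∀ j, j < σ.cls i → ¬ σ.B j ⊆ (U i).erase σ.a) ∧
    (∀ i, σ.a ∈ U i → Disjoint (E i) (insert (σ.c (σ.cls i)) (σ.D (σ.cls i))))

/-- Validity of a stage is decidable (so concrete schedules are checked by `decide`). -/
instance instDecidableValid (U E : Fin r → Finset (Fin h)) : Decidable (σ.Valid U E) := by
  unfold Valid; infer_instance

/-- **One valid stage** (the DT-peel lemma repackaged). -/
theorem genDet_ne_zero {s : ℕ} (hs : 1 ≤ s) (U E w : Fin r → Finset (Fin h)) (hv : σ.Valid U E)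
    (hne : genDet s h r (σ.newU U) (σ.newE U E) w ≠ 0) : genDet s h r U E w ≠ 0 :=
  genDet_ne_zero_of_peel hs hv.1 hv.2.1 hv.2.2.1 U E w σ.cls hv.2.2.2.1 hv.2.2.2.2.1 hv.2.2.2.2.2 _ _
    (fun _ => rfl) (fun _ => rfl) hne

end Stage

section Schedule

variable {r : ℕ}

/-- The `x`-sets after running a schedule. -/
def runU : List (Stage h r) → (Fin r → Finset (Fin h)) → (Fin r → Finset (Fin h))
  | [], U => U
  | σ :: rest, U => runU rest (σ.newU U)

/-- The `y`-shifts after running a schedule. -/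
def runE : List (Stage h r) → (Fin r → Finset (Fin h)) → (Fin r → Finset (Fin h)) → (Fin r → Finset (Fin h))
  | [], _, E => E
  | σ :: rest, U, E => runE rest (σ.newU U) (σ.newE U E)

/-- Validity of a schedule: every stage is valid on the rows it is applied to. -/
def ValidSched : List (Stage h r) → (Fin r → Finset (Fin h)) → (Fin r → Finset (Fin h)) → Prop
  | [], _, _ => True
  | σ :: rest, U, E => σ.Valid U E ∧ ValidSched rest (σ.newU U) (σ.newE U E)

/-- Validity of a schedule is decidable. -/
instance decValidSched : ∀ (L : List (Stage h r)) (U E : Fin r → Finset (Fin h)), Decidable (ValidSched L U E)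
  | [], _, _ => by unfold ValidSched; infer_instance
  | σ :: rest, U, E => by
      unfold ValidSched
      haveI := decValidSched rest (σ.newU U) (σ.newE U E)
      infer_instance

/-- **A valid schedule transfers non-vanishing back to the start.** -/
theorem genDet_ne_zero_of_schedule {s : ℕ} (hs : 1 ≤ s) (w : Fin r → Finset (Fin h)) :
    ∀ (L : List (Stage h r)) (U E : Fin r → Finset (Fin h)), ValidSched L U E →
      genDet s h r (runU L U) (runE L U E) w ≠ 0 → genDet s h r U E w ≠ 0
  | [], _, _, _, hne => hne
  | σ :: rest, U, E, hv, hne =>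
      σ.genDet_ne_zero hs U E w hv.1 (genDet_ne_zero_of_schedule hs w rest _ _ hv.2 hne)

/-- **MAIN THEOREM: an `x`-side ROUTING certifies the symbolic minor.** If a valid schedule turns the rows `(u i | ∅)` into
unit rows `(∅ | w (π i))` (`π` a permutation, `w` injective), then `symbolicDet s h r u w ≠ 0` (`s ≥ 1`). -/
theorem symbolicDet_ne_zero_of_routing {s : ℕ} (hs : 1 ≤ s) (u w : Fin r → Finset (Fin h))
    (hw : Function.Injective w) (L : List (Stage h r)) (hv : ValidSched L u (fun _ => ∅))
    (hU : ∀ i, runU L u i = ∅) (π : Equiv.Perm (Fin r)) (hE : ∀ i, runE L u (fun _ => ∅) i = w (π i)) :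
    symbolicDet s h r u w ≠ 0 := by
  rw [← genDet_empty]
  refine genDet_ne_zero_of_schedule hs w L u _ hv ?_
  have hfun : runU L u = fun _ => ∅ := funext hU
  rw [hfun]
  exact genDet_unit_ne_zero s h r w _ hw π hE

/-- The same with the conclusion `AnchoredHit` (via the landed `stub_genericPoint`). -/
theorem anchoredHit_of_routing {s : ℕ} (hs : 1 ≤ s) (u w : Fin r → Finset (Fin h))
    (hw : Function.Injective w) (L : List (Stage h r)) (hv : ValidSched L u (fun _ => ∅))
    (hU : ∀ i, runU L u i = ∅) (π : Equiv.Perm (Fin r)) (hE : ∀ i, runE L u (fun _ => ∅) i = w (π i)) :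
    AnchoredHit s h r u w :=
  stub_genericPoint s h r u w (symbolicDet_ne_zero_of_routing hs u w hw L hv hU π hE)

end Schedule

/-! ## 3. A worked instance: the full simplex pair `2^{[2]}` versus `2^{[2]}` -/

section Example

/-- The layout `(∅, {0}, {1}, {0,1})` on two vertices. -/
def exLayout : Fin 4 → Finset (Fin 2) := ![∅, {0}, {1}, {0, 1}]

/-- Stage at vertex `0`: types `({1} | c = 0 | ∅)`, `(∅ | c = 1 | ∅)`. -/
def exStage0 : Stage 2 4 where
  a := 0
  J := 2
  B := ![{1}, ∅]
  c := ![0, 1]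
  D := ![∅, ∅]
  cls := ![0, 1, 0, 0]

/-- Stage at vertex `1`: one type `(∅ | c = 0 | {1})`. -/
def exStage1 : Stage 2 4 where
  a := 1
  J := 1
  B := ![∅]
  c := ![0]
  D := ![{1}]
  cls := ![0, 0, 0, 0]

/-- The resulting bijection rows → columns. -/
def exPerm : Equiv.Perm (Fin 4) where
  toFun := ![0, 2, 3, 1]
  invFun := ![0, 3, 1, 2]
  left_inv := by decide
  right_inv := by decide

/-- **Example.** The routing `[exStage0, exStage1]` certifies the symbolic minor of 𝔄₁ on `(2^{[2]}, 2^{[2]})`. -/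
example : symbolicDet 1 2 4 exLayout exLayout ≠ 0 :=
  symbolicDet_ne_zero_of_routing le_rfl exLayout exLayout (by decide) [exStage0, exStage1] (by decide) (by decide)
    exPerm (by decide)

end Example

end DTPeel

end

end Summit.ValiantsHypothesis.ValiantsHypothesis.Theorems.BarrierLever.AnchoredPeeling
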